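import Summits.Ventures.GridStability.Models.Kundur2ASplitLurieLines

/-!
# GridStability/Models/NE39SplitLurieLines — the 39-bus LOSSY Kron-reduced classical model «NE39-pre-lossless-λ-h12»
# (`NE39.preLossless`: Padiyar App. D ten machines, line resistances dropped, LOAD TRANSFER CONDUCTANCES KEPT) with the
# declared uniform damping `λ = 1/10` AS lit-6's UNORDERED-LINES split Lur'e system (Pai (3.43)–(3.45))

Cell `gridfusion` (LADDER-GRIDFUSION G2.c lossy Lur'e tier — the 39-bus rung of memo §4's benchmark ladder); seat
gridfusion-lit-6 (g10).  The instance file of the generic `RecastData.splitLurieLinesSystemRel`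
(`Models/Kundur2ASplitLurieLines.lean`, p581098) for model-1's census record `NE39.preLossless : RecastData 9`
(`Models/NE39.lean`: the object of model-3's `NE39LossyLinearisation.lean`; its all-conductances-dropped twin is
`NE39L.data`, the ★ LFF-P2 / ★ #121 / ★ #124 object): `NE39.splitLurieLinesSystem := preLossless.splitLurieLinesSystemRel
(1/10) preLossless.angleOf` — 19 states `(ω₀ … ω₉ | σ₁ … σ₉) = Fin 10 ⊕ Fin 9`, 200 channels `(Fin 10 × Fin 10) ⊕ (Fin 10 ×
Fin 10)` (one SINE and one COSINE channel per ordered pair; the 45 lines `p < q` carry the inputs, the other 110 columns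
of `B` are zero; ALL DATA RATIONAL), its definitional unfoldings, the HYPOTHESIS-FREE bridge
`NE39.hasDerivWithinAt_lurieState_lines` (every solution of `NE39.preLossless.toModelRel (1/10) 0` drives the Lur'e state
along the split field), the exact channel trigonometry `sin/cos(θ*_p − θ*_q) = sd/cd p q`, and `|θ*_p − θ*_q| < π/2`
for all pairs (kernel: every `c_i > 0`, every `cd p q > 0`; the largest line angle is ≈ 38.6°).

THREE COLUMNS.  CERTIFIED: nothing (identities and a chain rule).  MODELLED: model-3's tokens for this object verbatim —
MV-2 (Kron reduction with the load conductances KEPT) + «lossless lines» + E-rounding + K-rounding h12 + MV-λ (uniform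
damping `D_i = λM_i`, `λ = 1/10` DECLARED; the printed `D = 0`) + MV-E6; `a′ = 0`; a census object, never a sentence
about the printed New England system or any grid.  VALIDATED: nothing.
[cite: Pai1981, §3.6.3 eqs. (3.43)–(3.45); SauerPai1998, §6.10 eqs. (6.242)–(6.244)]
-/

noncomputable section

open Real Set Filter Topology Finset
open Literature.MathematicalPhysics.PowerSystems
open Literature.MathematicalPhysics.PowerSystems.LyapunovFunctionFamily (System)

namespace Summit.Ventures.GridStability.Models

namespace NE39

/-- The UNORDERED-LINES split Lur'e system of `NE39.preLossless.toModelRel (1/10) 0` at its A1 equilibrium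
`preLossless.angleOf` (19 states; 200 channels, the 45 lines `p < q` active in each family; rational `A`, `B`, `C`).
[cite: Pai1981, §3.6.3 eq. (3.45)] -/
def splitLurieLinesSystem : System (Fin 10 ⊕ Fin 9) ((Fin 10 × Fin 10) ⊕ (Fin 10 × Fin 10)) :=
  preLossless.splitLurieLinesSystemRel (1 / 10) preLossless.angleOf

/-- `A` of the instance (definitional unfolding). [cite: Pai1981, §3.6.3 eq. (3.45)] -/
theorem splitLurieLinesSystem_A : splitLurieLinesSystem.A =
    Matrix.fromBlocks (-Matrix.diagonal
      (fun i => (preLossless.toModelRel (1 / 10) 0).toLitNode.D i / (preLossless.toModelRel (1 / 10) 0).toLitNode.M i))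
      0 (InternalNode.refT 9) 0 := rfl

/-- `B` of the instance (definitional unfolding). [cite: Pai1981, §3.6.3 eq. (3.45)] -/
theorem splitLurieLinesSystem_B : splitLurieLinesSystem.B =
    Matrix.fromRows (preLossless.toModelRel (1 / 10) 0).toLitNode.lineInput 0 := rfl

/-- `C` of the instance (definitional unfolding). [cite: Pai1981, §3.6.3 eq. (3.43)] -/
theorem splitLurieLinesSystem_C : splitLurieLinesSystem.C =
    Matrix.fromCols 0 (Matrix.fromRows (InternalNode.pairIncidence 9) (InternalNode.pairIncidence 9)) := rfl

/-- `δ*` of the instance is `splitShift preLossless.angleOf` (definitional unfolding). [cite: Pai1981, §3.6.3 eq. (3.44)] -/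
theorem splitLurieLinesSystem_δs : splitLurieLinesSystem.δs = InternalNode.splitShift preLossless.angleOf := rfl

/-- **HYPOTHESIS-FREE bridge**: every solution of `NE39.preLossless.toModelRel (1/10) 0` on `univ` drives the Lur'e
state along `NE39.splitLurieLinesSystem`. [cite: Pai1981, §3.6.3 eq. (3.45)] -/
theorem hasDerivWithinAt_lurieState_lines {c : ℝ → ClassicalSwing.State 10}
    (hc : (preLossless.toModelRel (1 / 10) 0).IsSolutionOn c univ) {s : Set ℝ} (t : ℝ) :
    HasDerivWithinAt (fun τ => preLossless.lurieState preLossless.angleOf (c τ))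
      (splitLurieLinesSystem.field (preLossless.lurieState preLossless.angleOf (c t))) s t :=
  preLossless.hasDerivWithinAt_lurieState_linesRel (1 / 10) preLossless_eqData hc t

/-- Exact channel sines: `sin(θ*_p − θ*_q) = sd p q` (rational) for the A1 equilibrium of record. -/
theorem sin_angleOf_sub (p q : Fin 10) :
    Real.sin (preLossless.angleOf p - preLossless.angleOf q) = ((preLossless.sd p q : ℚ) : ℝ) :=
  (preLossless.sd_cast preLossless_eqData p q).symm

/-- Exact channel cosines: `cos(θ*_p − θ*_q) = cd p q` (rational). -/
theorem cos_angleOf_sub (p q : Fin 10) :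
    Real.cos (preLossless.angleOf p - preLossless.angleOf q) = ((preLossless.cd p q : ℚ) : ℝ) :=
  (preLossless.cd_cast preLossless_eqData p q).symm

/-- Every node cosine of the record is positive (kernel). -/
theorem preLossless_c_pos : ∀ i : Fin 10, 0 < preLossless.c i := by decide +kernel

/-- Every line cosine `cd p q = c_pc_q + s_ps_q` of the record is positive (kernel; the largest line angle is
≈ 38.6°, the reference–machine-9 pair). -/
theorem preLossless_cd_pos : ∀ p q : Fin 10, 0 < preLossless.cd p q := by decide +kernel

/-- Every line angle of the A1 equilibrium lies in the Vu–Turitsyn window: `|θ*_p − θ*_q| < π/2`. -/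
theorem abs_angle_sub_lt (p q : Fin 10) : |preLossless.angleOf p - preLossless.angleOf q| < π / 2 :=
  preLossless.abs_angleOf_sub_lt_pi_div_two_of_cd_pos preLossless_eqData (preLossless_c_pos p)
    (preLossless_c_pos q) (preLossless_cd_pos p q)

end NE39

end Summit.Ventures.GridStability.Models

end
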